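/-
Copyright (c) 2026 the pub-hodgecm-mathlib formalisation cell (harness21).  Prover seat hodgecm-mathlib-K2E1-p13 (g2), Track B ∕ K2-LIT, h413 = `stmt-HodgeConjecture-24833`,
line `K2_E1_TraceFormulaBeta`, ROADCARD §3′ «M2 v2 SPECTRAL-MEASURE EXHAUSTION» (dealer K2E1-plan (g7) (181)) pre-deal D2′: a `{0, full}`-valued measure on a countably generated
σ-algebra is carried by ONE atom; countable traces of the atom on Lebesgue lines are null, so the line densities vanish.  Mathlib-only.
-/
import Mathlib.MeasureTheory.MeasurableSpace.CountablyGenerated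
import Mathlib.MeasureTheory.Measure.WithDensity
import Mathlib.MeasureTheory.Measure.Typeclasses.NullSingletonClass
import Mathlib.MeasureTheory.Measure.Typeclasses.ZeroOne
import HarnessLib

/-!
# D2′ — `K2E1ZeroOneMeasureAtom`: a `{0, full}`-valued measure sits on one atom; countable atom traces kill absolutely continuous line parts

Track B ∕ K2-LIT, crux h413 = `stmt-HodgeConjecture-24833`, route of record `HCCMUnconditional`; cell `hodgecm-mathlib`, squad K2, ENGINE E1.  THEOREMS ONLY (no `def`, no `instance`,
no `notation`, no `sorry`; default heartbeats); lane `--supports stmt-HodgeConjecture-24833 --as helper` (count-neutral).  ABSTRACT measure theory (Mathlib currency: `measurableAtom`,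
`MeasurableSpace.CountablyGenerated`, `Measure.withDensity`, `NullSingletonClass`, `IsZeroOneMeasure`); no automorphic object.

WHERE IT IS USED (ROADCARD §3′.1, files D5′∕D6′): for an irreducible closed `G(𝔸)`-stable `π ≤ (L²_cusp)ᗮ` and a unit vector `v ∈ π`, the spectral projections `𝕄_B` of the countable
arch-central symbol family give a measure `ν_v(B) = ‖𝕄_B v‖²` on `(Ω, 𝔅)`, `𝔅` countably generated, which is `{0, 1}`-VALUED (`𝕄_B P_π` projects onto `π ∩ range 𝕄_B ∈ {0, π}`).
§1 ⇒ `ν_v` is carried by one `𝔅`-atom `A`; D3-lite (★ `K2E1ArchCentralSymbolsSeparateU11`) ⇒ `A` meets every spectral line in `≤ 2` points; §3 ⇒ the absolutely continuous line parts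
`|U v|²·dy` of `ν_v` vanish ⇒ `v` is residual.
* §0 `countablyGenerated_generateFrom` — `σ(b)` is countably generated for countable `b` (D5′'s `𝔅 = σ`(countable symbol family)).
* §1 **`exists_atom_of_forall_null_or_conull`** (sequence form, NO σ-algebra hypothesis): if every `G n` is null or co-null for `ν` and `ν ≠ 0`, some `ω` has
  `ν {ω′ | ∀ n, ω′ ∈ G n ↔ ω ∈ G n}ᶜ = 0` (take the null side of each `G n`; their union is null; any `ω` off it); **`exists_measure_compl_measurableAtom_eq_zero`** (countably generated
  form, Mathlib's `measurableAtom`): `ν s ∈ {null, co-null}` for all measurable `s`, `ν ≠ 0` ⇒ `∃ ω, ν (measurableAtom ω)ᶜ = 0`; and the finite-measure phrasing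
  **`exists_measure_compl_measurableAtom_eq_zero_of_zero_or_univ`** (`ν s ∈ {0, ν univ}`) ∕ **`…_of_isZeroOneMeasure`** (Mathlib `IsZeroOneMeasure`, `NeZero ν`; no
  standard-Borel hypothesis, unlike Mathlib `IsZeroOneMeasure.exists_eq_dirac`).
* §2 `measure_eq_zero_of_countable_of_absolutelyContinuous` — `ρ ≪ μ`, `μ` with null singletons (Lebesgue), `s` countable ⇒ `ρ s = 0` (Mathlib `Set.Countable.measure_zero`).
* §3 **`measure_eq_zero_of_preimage_atom`** (line lemma): `ν Aᶜ = 0`, a measure `ρ` on a line `ℓ : X → Ω` dominated on `ℓ⁻¹ Aᶜ` by `ν Aᶜ` and null on `ℓ⁻¹ A` is ZERO;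
  **`density_ae_eq_zero_of_atom`**: with `ρ = μ.withDensity d ≪ μ` (`μ` atomless, e.g. Lebesgue), `(μ.withDensity d).map ℓ ≤ ν`, and `ℓ⁻¹ A` countable ⇒ `d = 0` `μ`-a.e.; the family
  wrapper `densities_ae_eq_zero_of_atom` (countably many lines at once — the exact shape of §3′.1's conclusion «the continuous component of `U v` vanishes»).
HONEST LABEL: HC_CM is proved only modulo the 7 printed citations (2 remaining named inputs: hLiu418 = `stmt-HodgeConjecture-24832`, h413 = `stmt-HodgeConjecture-24833`) until rung 0
closes; this file asserts no named fact, closes no socket; count-neutral; letter-free.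
[cite: Kallenberg2002, Ch. 1 (atoms of a σ-field, zero–one measures)] [folklore]

## References
* [Kallenberg2002] O. Kallenberg, *Foundations of Modern Probability* (2nd ed., 2002), Ch. 1 (σ-fields, atoms, measures).
-/

set_option autoImplicit false
set_option linter.dupNamespace false  -- the mandated namespace repeats the summit's segment (`HodgeConjecture.HodgeConjecture`)

noncomputable section

open MeasureTheory Measure Set Filter
open scoped ENNReal

namespace Summit.HodgeConjecture.HodgeConjecture.Cruxes.H413.K2E1ZeroOneMeasureAtom

/-! ## §0 Countable generation of `σ(b)` -/

/-- **`σ(b)` is countably generated for a countable family `b`** (by definition of `MeasurableSpace.CountablyGenerated`). [folklore] -/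
theorem countablyGenerated_generateFrom {Ω : Type*} {b : Set (Set Ω)} (hb : b.Countable) :
    @MeasurableSpace.CountablyGenerated Ω (MeasurableSpace.generateFrom b) :=
  @MeasurableSpace.CountablyGenerated.mk Ω (MeasurableSpace.generateFrom b) ⟨b, hb, rfl⟩

/-! ## §1 A `{null, co-null}`-valued measure is carried by one atom -/

section Atom

variable {Ω : Type*} [MeasurableSpace Ω]

/-- **SEQUENCE FORM (no σ-algebra hypothesis).**  If each `G n` is `ν`-null or `ν`-co-null and `ν ≠ 0`, then for some `ω` the "atom" `{ω′ | ∀ n, ω′ ∈ G n ↔ ω ∈ G n}` is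
`ν`-co-null: choose the null side `N n` of each `G n`; `⋃ N n` is null, so some `ω` lies off it, and every `ω′` disagreeing with `ω` on some `G n` lies in `N n`.
[cite: Kallenberg2002, Ch. 1] -/
theorem exists_atom_of_forall_null_or_conull (ν : Measure Ω) (G : ℕ → Set Ω) (h01 : ∀ n, ν (G n) = 0 ∨ ν (G n)ᶜ = 0) (h0 : ν univ ≠ 0) :
    ∃ ω : Ω, ν {ω' | ∀ n, ω' ∈ G n ↔ ω ∈ G n}ᶜ = 0 := by
  classical
  -- the null side of each generator and their (null) union
  obtain ⟨N, hN⟩ : ∃ N : ℕ → Set Ω, N = fun n => if ν (G n) = 0 then G n else (G n)ᶜ := ⟨_, rfl⟩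
  have hN0 : ∀ n, ν (N n) = 0 := fun n => by
    rw [hN]
    dsimp only
    split_ifs with h
    · exact h
    · exact (h01 n).resolve_left h
  have hU0 : ν (⋃ n, N n) = 0 := measure_iUnion_null hN0
  -- a point off the null union
  have hne : (⋃ n, N n)ᶜ.Nonempty := by
    by_contra h
    rw [not_nonempty_iff_eq_empty, compl_empty_iff] at h
    exact h0 (measure_mono_null (subset_univ _ |>.trans (h ▸ Subset.rfl)) hU0)
  obtain ⟨ω, hω⟩ := hne
  refine ⟨ω, measure_mono_null (fun ω' hω' => ?_) hU0⟩
  -- `ω′` disagrees with `ω` on some `G n`; then `ω′ ∈ N n`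
  rw [mem_compl_iff, mem_setOf_eq, not_forall] at hω'
  obtain ⟨n, hn⟩ := hω'
  have hωn : ω ∉ N n := fun h => hω (mem_iUnion.2 ⟨n, h⟩)
  refine mem_iUnion.2 ⟨n, ?_⟩
  rw [hN] at hωn ⊢
  dsimp only at hωn ⊢
  split_ifs at hωn ⊢ with h
  · -- `N n = G n`, `ω ∉ G n`, so `ω′ ∈ G n`
    by_contra hω'n
    exact hn ⟨fun h' => (hω'n h').elim, fun h' => (hωn h').elim⟩
  · -- `N n = (G n)ᶜ`, `ω ∈ G n`, so `ω′ ∉ G n`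
    rw [mem_compl_iff, not_not] at hωn
    exact fun hω'n => hn ⟨fun _ => hωn, fun _ => hω'n⟩

/-- **COUNTABLY GENERATED FORM (Mathlib's `measurableAtom`).**  On a countably generated measurable space, a measure `ν ≠ 0` for which every measurable set is null or co-null is
carried by ONE atom: `∃ ω, ν (measurableAtom ω)ᶜ = 0` (§1 on Mathlib's `natGeneratingSequence`; `measurableAtom ω` is the `countablyGeneratedAtom` of the membership pattern of `ω`,
Mathlib `measurableAtom_eq_countablyGeneratedAtom_natGeneratingSequence`). [cite: Kallenberg2002, Ch. 1] -/
theorem exists_measure_compl_measurableAtom_eq_zero [MeasurableSpace.CountablyGenerated Ω] (ν : Measure Ω)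
    (h01 : ∀ s : Set Ω, MeasurableSet s → ν s = 0 ∨ ν sᶜ = 0) (h0 : ν univ ≠ 0) :
    ∃ ω : Ω, ν (measurableAtom ω)ᶜ = 0 := by
  classical
  obtain ⟨ω, hω⟩ := exists_atom_of_forall_null_or_conull ν (MeasurableSpace.natGeneratingSequence Ω)
    (fun n => h01 _ (MeasurableSpace.measurableSet_natGeneratingSequence n)) h0
  refine ⟨ω, measure_mono_null (compl_subset_compl.2 fun ω' hω' => ?_) hω⟩
  -- the pattern set of `ω` is contained in `measurableAtom ω`
  rw [MeasurableSpace.measurableAtom_eq_countablyGeneratedAtom_natGeneratingSequence, MeasurableSpace.countablyGeneratedAtom, mem_iInter]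
  intro n
  by_cases h : ω ∈ MeasurableSpace.natGeneratingSequence Ω n
  · rw [if_pos h]; exact (hω' n).2 h
  · rw [if_neg h]; exact fun h' => h ((hω' n).1 h')

/-- **FINITE-MEASURE PHRASING**: `ν s ∈ {0, ν univ}` for every measurable `s` (the `{0,1}`-valued measures `B ↦ ‖𝕄_B v‖²` of §3′.1, `‖v‖ = 1`) and `ν ≠ 0` ⇒ `∃ ω, ν (measurableAtom ω)ᶜ = 0`.
[cite: Kallenberg2002, Ch. 1] -/
theorem exists_measure_compl_measurableAtom_eq_zero_of_zero_or_univ [MeasurableSpace.CountablyGenerated Ω] (ν : Measure Ω) [IsFiniteMeasure ν]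
    (h01 : ∀ s : Set Ω, MeasurableSet s → ν s = 0 ∨ ν s = ν univ) (h0 : ν univ ≠ 0) :
    ∃ ω : Ω, ν (measurableAtom ω)ᶜ = 0 :=
  exists_measure_compl_measurableAtom_eq_zero ν (fun s hs => (h01 s hs).imp_right fun h => by rw [measure_compl hs (measure_ne_top ν s), h, tsub_self]) h0

/-- **MATHLIB `IsZeroOneMeasure` PHRASING**: a non-zero zero–one measure on a countably generated space is carried by one `measurableAtom` (no standard-Borel hypothesis — compare
Mathlib `IsZeroOneMeasure.exists_eq_dirac`, which needs `StandardBorelSpace`; the symbol σ-algebra of ROADCARD §3′.1 does not separate points). [cite: Kallenberg2002, Ch. 1] -/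
theorem exists_measure_compl_measurableAtom_eq_zero_of_isZeroOneMeasure [MeasurableSpace.CountablyGenerated Ω] (ν : Measure Ω) [IsZeroOneMeasure ν] [NeZero ν] :
    ∃ ω : Ω, ν (measurableAtom ω)ᶜ = 0 := by
  have h0 : ν univ ≠ 0 := measure_univ_ne_zero.2 (NeZero.ne ν)
  have h1 : ν univ = 1 := (Measure.zero_one ν univ).resolve_left h0
  haveI : IsFiniteMeasure ν := ⟨by rw [h1]; exact ENNReal.one_lt_top⟩
  exact exists_measure_compl_measurableAtom_eq_zero_of_zero_or_univ ν (fun s _ => by rw [h1]; exact Measure.zero_one ν s) h0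

end Atom

/-! ## §2 Countable sets are null for measures absolutely continuous with respect to an atomless measure -/

/-- **`ρ ≪ μ`, `μ` without atoms, `s` countable ⇒ `ρ s = 0`** (Mathlib `Set.Countable.measure_zero`). [folklore] -/
theorem measure_eq_zero_of_countable_of_absolutelyContinuous {X : Type*} [MeasurableSpace X] {ρ μ : Measure X} [NullSingletonClass μ] (h : ρ ≪ μ) {s : Set X} (hs : s.Countable) :
    ρ s = 0 :=
  h (hs.measure_zero μ)

/-! ## §3 The line lemma: an absolutely continuous line part carried by a countable atom trace vanishes -/

section Line

variable {Ω X : Type*} [MeasurableSpace Ω] [MeasurableSpace X]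

/-- **LINE LEMMA.**  `A ⊆ Ω` is `ν`-co-null; a measure `ρ` on a "line" `ℓ : X → Ω` is dominated by `ν` on `ℓ⁻¹ Aᶜ` (`ρ (ℓ⁻¹ Aᶜ) ≤ ν Aᶜ`, e.g. `ρ.map ℓ ≤ ν`) and null on `ℓ⁻¹ A` (e.g. a countable
trace, §2).  THEN `ρ = 0`. [folklore] -/
theorem measure_eq_zero_of_preimage_atom {ν : Measure Ω} {A : Set Ω} (hA : ν Aᶜ = 0) (ρ : Measure X) (ℓ : X → Ω) (hdom : ρ (ℓ ⁻¹' Aᶜ) ≤ ν Aᶜ) (hρA : ρ (ℓ ⁻¹' A) = 0) :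
    ρ = 0 := by
  rw [← measure_univ_eq_zero]
  have hcover : (univ : Set X) ⊆ ℓ ⁻¹' A ∪ ℓ ⁻¹' Aᶜ := fun x _ => (em (ℓ x ∈ A)).imp id id
  refine le_antisymm ((measure_mono hcover).trans ((measure_union_le _ _).trans ?_)) zero_le
  rw [hρA, zero_add]
  exact hdom.trans (le_of_eq hA)

/-- **THE LINE DENSITY VANISHES** (the shape used in D5′): `μ` an atomless measure on the line (Lebesgue), `d` a density with `(μ.withDensity d).map ℓ ≤ ν` along a measurable
`ℓ : X → Ω`, `A` measurable and `ν`-co-null with COUNTABLE trace `ℓ⁻¹ A` (D3-lite: an atom meets each spectral line in `≤ 2` points) ⇒ `d = 0` `μ`-almost everywhere. [folklore] -/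
theorem density_ae_eq_zero_of_atom {ν : Measure Ω} {A : Set Ω} (hAm : MeasurableSet A) (hA : ν Aᶜ = 0) (μ : Measure X) [NullSingletonClass μ] {d : X → ℝ≥0∞} (hd : AEMeasurable d μ)
    {ℓ : X → Ω} (hℓ : Measurable ℓ) (hle : (μ.withDensity d).map ℓ ≤ ν) (hcount : (ℓ ⁻¹' A).Countable) : d =ᵐ[μ] 0 := by
  rw [← withDensity_eq_zero_iff hd]
  refine measure_eq_zero_of_preimage_atom hA _ ℓ ?_ (measure_eq_zero_of_countable_of_absolutelyContinuous (withDensity_absolutelyContinuous μ d) hcount)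
  rw [← Measure.map_apply hℓ hAm.compl]
  exact Measure.le_iff'.1 hle _

/-- **ALL LINE DENSITIES VANISH** (family wrapper: countably — indeed arbitrarily — many lines `ℓ i : X i → Ω`, each carrying the absolutely continuous part `μ_i.withDensity (d i)` of `ν`):
the conclusion «the continuous component of `U v` is zero» of ROADCARD §3′.1. [folklore] -/
theorem densities_ae_eq_zero_of_atom {ι : Type*} {Y : ι → Type*} [∀ i, MeasurableSpace (Y i)] {ν : Measure Ω} {A : Set Ω} (hAm : MeasurableSet A) (hA : ν Aᶜ = 0)
    (μ : (i : ι) → Measure (Y i)) [∀ i, NullSingletonClass (μ i)] {d : (i : ι) → Y i → ℝ≥0∞} (hd : ∀ i, AEMeasurable (d i) (μ i))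
    {ℓ : (i : ι) → Y i → Ω} (hℓ : ∀ i, Measurable (ℓ i)) (hle : ∀ i, ((μ i).withDensity (d i)).map (ℓ i) ≤ ν) (hcount : ∀ i, (ℓ i ⁻¹' A).Countable) :
    ∀ i, d i =ᵐ[μ i] 0 := fun i =>
  density_ae_eq_zero_of_atom hAm hA (μ i) (hd i) (hℓ i) (hle i) (hcount i)

end Line

/-! ## §4 The two steps combined: from the `{null, co-null}` property to vanishing line densities -/

/-- **COMBINATION** (§1 ∘ §3): on a countably generated `(Ω, 𝔅)`, a measure `ν ≠ 0` with every measurable set null or co-null, and lines `ℓ i` carrying absolutely continuous parts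
`(μ_i.withDensity d_i).map ℓ_i ≤ ν` whose pull-backs of EVERY atom `measurableAtom ω` are countable ⇒ some atom carries `ν` and ALL line densities vanish a.e.
[cite: Kallenberg2002, Ch. 1] -/
theorem exists_atom_and_densities_ae_eq_zero {Ω : Type*} [MeasurableSpace Ω] [MeasurableSpace.CountablyGenerated Ω] (ν : Measure Ω)
    (h01 : ∀ s : Set Ω, MeasurableSet s → ν s = 0 ∨ ν sᶜ = 0) (h0 : ν univ ≠ 0)
    {ι : Type*} {Y : ι → Type*} [∀ i, MeasurableSpace (Y i)] (μ : (i : ι) → Measure (Y i)) [∀ i, NullSingletonClass (μ i)]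
    {d : (i : ι) → Y i → ℝ≥0∞} (hd : ∀ i, AEMeasurable (d i) (μ i)) {ℓ : (i : ι) → Y i → Ω} (hℓ : ∀ i, Measurable (ℓ i))
    (hle : ∀ i, ((μ i).withDensity (d i)).map (ℓ i) ≤ ν) (hcount : ∀ (ω : Ω) (i : ι), (ℓ i ⁻¹' measurableAtom ω).Countable) :
    ∃ ω : Ω, ν (measurableAtom ω)ᶜ = 0 ∧ ∀ i, d i =ᵐ[μ i] 0 := by
  obtain ⟨ω, hω⟩ := exists_measure_compl_measurableAtom_eq_zero ν h01 h0
  exact ⟨ω, hω, densities_ae_eq_zero_of_atom (MeasurableSpace.measurableSet_measurableAtom ω) hω μ hd hℓ hle (hcount ω)⟩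

end Summit.HodgeConjecture.HodgeConjecture.Cruxes.H413.K2E1ZeroOneMeasureAtom

end
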